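import Literature.Topology.FourManifolds.LatticeFormsOrthogonalGroupNegReflections
import HarnessLib

/-!
# `⟨σ_v : v² = +2⟩ = O⁺(U^{⊕n}(−1)) = ker(χ·det)`: Kneser's theorem "with opposite signs" for `U^{⊕n}`, `n ≥ 3`, and the three
# index-two subgroups of `O(U^{⊕n})` over `SO⁺` as reflection groups
# (Gritsenko–Hulek–Sankaran, *J. Algebra* 322 (2009) Thm. 1.1, Cor. 1.2 "also true with opposite signs"; GHS 2007 §3; Markman 2023 §5.1)

Trunk T-4MAN vocabulary. `O(U^{⊕n})/SO⁺(U^{⊕n}) ≅ {±1}²` via `(χ, det)` (rows g50-#2/#6), so `O(U^{⊕n})` has exactly three subgroups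
of index two containing `SO⁺`: `O⁺ = ker χ`, `SO = ker det`, and `ker(χ·det)` — the last being `O⁺(L(−1))`, the kernel of the
orientation character of the NEGATIVE definite `n`-planes (`det = χ₊χ₋`, row g48-#2). Rows g49-#15 / g50-#4 gave generators of the
first two (`(−2)`-reflections; products of two `(±2)`-reflections). This file identifies the third: the `(+2)`-reflections generate
exactly `ker(χ·det) = O⁺(U^{⊕n}(−1))` — Kneser's Theorem 1.1 / Cor. 1.2 for the rescaled lattice `U^{⊕n}(−1) ≅ U^{⊕n}` ("also true
with opposite signs … reflections `σ_a` with `a² = 2`"); and it completes row g50-#7: the negated `(−2)`-reflections generate `O⁺`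
for `n` even and `ker(χ·det)` for `n` odd. Written for lane `lit-hodgefound`
(Track 2 foundations; prover seat `lit-hodgefound-p18`, gen 50, row g50-#8). THEOREMS ONLY — no definition, no named fact, no
instance, no notation.

## Sources, verbatim

* GHS 2009 (held `paper:arxiv-0810.1614`) p. 3: "**Theorem 1.1** ([Kn1]) […] `O′(L)` is generated by the products of reflections
  `σ_aσ_b` where `a, b ∈ L` and `a² = b² = −2`." "**Corollary 1.2** If `L` satisfies the Kneser conditions, then `O′(L) = S̃O⁺(L)`."
  "Note that Corollary 1.2 is also true with opposite signs, i.e. if `L` contains at least one `2`-vector and we consider the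
  reflections `σ_a` with `a² = 2`. To see this, simply multiply the quadratic form of the lattice `L` by `−1`." p. 3: "For an
  indefinite lattice there are two ways to choose the real spinor norm because `O(L,b) = O(L,−b)`".
* GHS 2007 (cited key `GritsenkoHulekSankaran2007HM`) §3: "`O⁺(L) = Ker(sn_{−1}) ∩ O(L)`" (the two orientation characters; `det = χ₊χ₋`
  is row g48-#2's `isOrientationPreserving_realForm_neg_iff`).

## Contents (all proved)

* §1 (any symmetric non-degenerate lattice) the predicate `χ(φ) ⟺ det φ = 1` ("`φ ⊗ ℝ ∈ O⁺(L(−1))`") is a subgroup condition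
  preserved by words: it holds for every word in generators satisfying it (`IsWordIn.isOrientationPreserving_iff_det_eq_one`); `σ_r² = id`.
* §2 `U^{⊕n}`, `n ≥ 3`: **`⟨σ_v : v² = +2⟩ = {φ : χ(φ) ⟺ det φ = 1}`** (`hyperbolicSum_isWordIn_posTwoReflections_iff`) **`= O⁺(U^{⊕n}(−1))`**
  (`hyperbolicSum_isWordIn_posTwoReflections_iff_realForm_neg`); the negated reflections: `⟨−σ_v : v² = −2⟩ = ker(χ·det)` for `n` odd
  (`hyperbolicSum_isWordIn_negNegTwoReflections_iff_of_odd`).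
* §3 model-free `⟨σ_v : v² = +2⟩ = ker(χ·det)` for every `L ≅ U^{⊕n}` and the genus `II_{n,n}`, `n ≥ 3` (`IsWordIn.posTwoReflections_conj`).
-/

noncomputable section

open Module
open LinearMap (BilinForm)
open LinearMap.BilinForm
open LinearMap.BilinForm (IsometryEquiv)

namespace Literature.Topology.FourManifolds

universe u

/-! ### §1 `ker(χ·det)` is a subgroup -/

section Kernel

variable {L : Type u} [AddCommGroup L] [Module.Finite ℤ L] [Module.Free ℤ L] {Q : BilinForm ℤ L}

/-- **Words in generators from `ker(χ·det)` stay in `ker(χ·det)`**: if every `s ∈ S` satisfies `χ(s) ⟺ det s = 1`, so does every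
word in `S` (`χ` and `det` are characters; `Q` symmetric non-degenerate). [cite: GritsenkoHulekSankaran2007HM, §3 ("O⁺(L) = Ker(sn_{−1}) ∩ O(L)")] [cite: GritsenkoHulekSankaran2009, Cor. 1.2 ("also true with opposite signs")] -/
theorem IsWordIn.isOrientationPreserving_iff_det_eq_one (hQ : Q.IsSymm) (hnd : Q.Nondegenerate) {S : Set (Q.IsometryEquiv Q)}
    (hS : ∀ s ∈ S, s.IsOrientationPreserving ↔ LinearMap.det ((s : Q.IsometryEquiv Q) : L →ₗ[ℤ] L) = 1) {φ : Q.IsometryEquiv Q}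
    (hφ : IsWordIn S φ) : φ.IsOrientationPreserving ↔ LinearMap.det (φ : L →ₗ[ℤ] L) = 1 := by
  refine hφ.induction_on (P := fun χ ↦ χ.IsOrientationPreserving ↔ LinearMap.det ((χ : Q.IsometryEquiv Q) : L →ₗ[ℤ] L) = 1) hS
    (iff_of_true LinearMap.BilinForm.IsometryEquiv.IsOrientationPreserving.refl specialOrthogonal_refl.2) (fun ψ χ hψ hχ ↦ ?_)
    fun ψ hψ ↦ ?_
  · rw [LinearMap.BilinForm.IsometryEquiv.isOrientationPreserving_trans_iff hQ hnd, IsometryEquiv.det_trans_eq_mul, hψ, hχ]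
    rcases LinearMap.BilinForm.IsometryEquiv.det_eq_one_or_eq_neg_one ψ with h | h <;>
      rcases LinearMap.BilinForm.IsometryEquiv.det_eq_one_or_eq_neg_one χ with h' | h' <;> simp [h, h']
  · rw [LinearMap.BilinForm.IsometryEquiv.isOrientationPreserving_symm_iff hQ hnd, IsometryEquiv.det_symm_eq, hψ]

/-- A reflection involution: `σ_r (σ_r v) = v`. [cite: MilnorHusemoller1973, §I.3] -/
theorem normTwoReflectionEquiv_apply_apply {W : Type*} [AddCommGroup W] {B : BilinForm ℤ W} (hB : B.IsSymm) (r : W) (ε : ℤ)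
    (hr : B r r = ε + ε) (hε : ε * ε = 1) (v : W) :
    normTwoReflectionEquiv hB r ε hr hε (normTwoReflectionEquiv hB r ε hr hε v) = v := by
  conv_lhs => rw [← normTwoReflectionEquiv_symm hB r ε hr hε]
  exact LinearMap.BilinForm.IsometryEquiv.symm_apply_apply _ v

end Kernel

/-! ### §2 `U^{⊕n}`, `n ≥ 3` -/

section HyperbolicSum

/-- **Kneser "with opposite signs" for `U^{⊕n}`, `n ≥ 3`: `⟨σ_v : v² = +2⟩ = ker(χ·det)`** — an isometry of `hyperbolicSum n` is a word
in the `(+2)`-reflections iff `χ(φ) ⟺ det φ = 1` (each `σ_v`, `v² = 2`, has `χ = −1`, `det = −1`; conversely `SO⁺ = ⟨σ_aσ_b : a² = b² = 2⟩`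
and the other coset is `SO⁺·σ_{e+f}`). [cite: GritsenkoHulekSankaran2009, Thm. 1.1 and Cor. 1.2 ("also true with opposite signs")] -/
theorem hyperbolicSum_isWordIn_posTwoReflections_iff {n : ℕ} (hn : 3 ≤ n) (φ : (hyperbolicSum n).IsometryEquiv (hyperbolicSum n)) :
    IsWordIn {ψ : (hyperbolicSum n).IsometryEquiv (hyperbolicSum n) | ∃ (r : (Fin n → ℤ) × (Fin n → ℤ))
        (hr : hyperbolicSum n r r = 1 + 1), ψ = normTwoReflectionEquiv (isSymm_hyperbolicSum n) r 1 hr (by norm_num)} φ ↔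
      (φ.IsOrientationPreserving ↔ LinearMap.det (φ : (Fin n → ℤ) × (Fin n → ℤ) →ₗ[ℤ] (Fin n → ℤ) × (Fin n → ℤ)) = 1) := by
  have hB := isSymm_hyperbolicSum n
  have hnd := (isUnimodular_hyperbolicSum n).nondegenerate
  have hgen : ∀ s ∈ {ψ : (hyperbolicSum n).IsometryEquiv (hyperbolicSum n) | ∃ (r : (Fin n → ℤ) × (Fin n → ℤ))
      (hr : hyperbolicSum n r r = 1 + 1), ψ = normTwoReflectionEquiv hB r 1 hr (by norm_num)},
      s.IsOrientationPreserving ↔ LinearMap.det ((s : (hyperbolicSum n).IsometryEquiv (hyperbolicSum n)) :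
        (Fin n → ℤ) × (Fin n → ℤ) →ₗ[ℤ] (Fin n → ℤ) × (Fin n → ℤ)) = 1 := by
    rintro s ⟨r, hr, rfl⟩
    rw [isOrientationPreserving_normTwoReflectionEquiv_iff _ hB hnd, det_normTwoReflectionEquiv _ hB]
    norm_num
  refine ⟨fun hφ ↦ hφ.isOrientationPreserving_iff_det_eq_one hB hnd hgen, fun h ↦ ?_⟩
  -- the pairs generate `SO⁺`; the odd coset is reached through `σ₊ = σ_{e₀+f₀}`
  have hpairs : ∀ ψ : (hyperbolicSum n).IsometryEquiv (hyperbolicSum n), ψ.IsOrientationPreserving →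
      LinearMap.det (ψ : (Fin n → ℤ) × (Fin n → ℤ) →ₗ[ℤ] (Fin n → ℤ) × (Fin n → ℤ)) = 1 →
      IsWordIn {ψ : (hyperbolicSum n).IsometryEquiv (hyperbolicSum n) | ∃ (r : (Fin n → ℤ) × (Fin n → ℤ))
        (hr : hyperbolicSum n r r = 1 + 1), ψ = normTwoReflectionEquiv hB r 1 hr (by norm_num)} ψ := fun ψ h₁ h₂ ↦ by
    refine ((hyperbolicSum_isWordIn_posTwoReflectionPairs_iff hn ψ).2 ⟨h₁, h₂⟩).bind fun s hs ↦ ?_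
    obtain ⟨a, b, ha, hb, rfl⟩ := hs
    refine IsWordIn.trans ?_ ?_
    · exact IsWordIn.of_mem ⟨a, ha, rfl⟩
    · exact IsWordIn.of_mem ⟨b, hb, rfl⟩
  rcases LinearMap.BilinForm.IsometryEquiv.det_eq_one_or_eq_neg_one φ with hd | hd
  · exact hpairs φ (h.2 hd) hd
  · have hφO : ¬ φ.IsOrientationPreserving := fun h' ↦ by rw [h.1 h'] at hd; norm_num at hd
    have hv := hyperbolicSum_single_single n ⟨0, by omega⟩
    set σ := normTwoReflectionEquiv hB (Pi.single (⟨0, by omega⟩ : Fin n) 1, Pi.single (⟨0, by omega⟩ : Fin n) 1) 1 hv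
      (by norm_num) with hσ
    have hσO : ¬ σ.IsOrientationPreserving := by
      rw [hσ, isOrientationPreserving_normTwoReflectionEquiv_iff _ hB hnd]
      norm_num
    have hφσ : IsWordIn {ψ : (hyperbolicSum n).IsometryEquiv (hyperbolicSum n) | ∃ (r : (Fin n → ℤ) × (Fin n → ℤ))
        (hr : hyperbolicSum n r r = 1 + 1), ψ = normTwoReflectionEquiv hB r 1 hr (by norm_num)} (φ.trans σ) := by
      refine hpairs _ ?_ ?_
      · rw [LinearMap.BilinForm.IsometryEquiv.isOrientationPreserving_trans_iff hB hnd]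
        exact iff_of_false hσO hφO
      · rw [IsometryEquiv.det_trans_eq_mul, hσ, det_normTwoReflectionEquiv _ hB, hd]
        norm_num
    refine (hφσ.trans (IsWordIn.of_mem ⟨_, hv, rfl⟩)).congr fun v ↦ ?_
    rw [LinearMap.BilinForm.IsometryEquiv.trans_apply, LinearMap.BilinForm.IsometryEquiv.trans_apply, ← hσ,
      normTwoReflectionEquiv_apply_apply]

/-- **`⟨σ_v : v² = +2⟩ = O⁺(U^{⊕n}(−1))`, `n ≥ 3`**: a word in the `(+2)`-reflections iff `φ ⊗ ℝ` preserves the orientation of the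
negative definite `n`-planes — Kneser's theorem for the lattice with the form multiplied by `−1` ("simply multiply the quadratic form
of the lattice `L` by `−1`"). [cite: GritsenkoHulekSankaran2009, Cor. 1.2 ("also true with opposite signs")] [cite: GritsenkoHulekSankaran2007HM, §3] -/
theorem hyperbolicSum_isWordIn_posTwoReflections_iff_realForm_neg {n : ℕ} (hn : 3 ≤ n)
    (φ : (hyperbolicSum n).IsometryEquiv (hyperbolicSum n)) :
    IsWordIn {ψ : (hyperbolicSum n).IsometryEquiv (hyperbolicSum n) | ∃ (r : (Fin n → ℤ) × (Fin n → ℤ))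
        (hr : hyperbolicSum n r r = 1 + 1), ψ = normTwoReflectionEquiv (isSymm_hyperbolicSum n) r 1 hr (by norm_num)} φ ↔
      Literature.LinearAlgebra.QuadraticForm.IsOrientationPreserving (LinearMap.BilinForm.realForm (-hyperbolicSum n))
        (LinearMap.BilinForm.realEnd (φ : (Fin n → ℤ) × (Fin n → ℤ) →ₗ[ℤ] (Fin n → ℤ) × (Fin n → ℤ))) := by
  rw [hyperbolicSum_isWordIn_posTwoReflections_iff hn,
    LinearMap.BilinForm.IsometryEquiv.isOrientationPreserving_realForm_neg_iff _ (isSymm_hyperbolicSum n)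
      (isUnimodular_hyperbolicSum n).nondegenerate]

/-- **`⟨−σ_v : v² = −2⟩ = ker(χ·det)` for `n ≥ 3` ODD** (companion of row g50-#7's even case `= O⁺`): for odd `n`, `−id ∉ O⁺`, so the
negated `(−2)`-reflections have `(χ, det) = (−1, −1)` and generate `SO⁺ ⊔ SO⁺·(−σ_{e−f})`.
[cite: Markman2023GeneralizedKummers, §5.1 (Lemma, "ρ maps Pin(V) onto O₊(V)" — the case rk ≡ 0 mod 4)] [cite: GritsenkoHulekSankaran2009, Thm. 1.1] -/
theorem hyperbolicSum_isWordIn_negNegTwoReflections_iff_of_odd {n : ℕ} (hn : 3 ≤ n) (hodd : Odd n)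
    (φ : (hyperbolicSum n).IsometryEquiv (hyperbolicSum n)) :
    IsWordIn {χ : (hyperbolicSum n).IsometryEquiv (hyperbolicSum n) | ∃ s ∈ {ψ : (hyperbolicSum n).IsometryEquiv (hyperbolicSum n) |
        ∃ (r : (Fin n → ℤ) × (Fin n → ℤ)) (hr : hyperbolicSum n r r = -1 + -1),
          ψ = normTwoReflectionEquiv (isSymm_hyperbolicSum n) r (-1) hr (by norm_num)},
        χ = s.trans (LinearMap.BilinForm.IsometryEquiv.neg (hyperbolicSum n))} φ ↔
      (φ.IsOrientationPreserving ↔ LinearMap.det (φ : (Fin n → ℤ) × (Fin n → ℤ) →ₗ[ℤ] (Fin n → ℤ) × (Fin n → ℤ)) = 1) := by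
  have hB := isSymm_hyperbolicSum n
  have hnd := (isUnimodular_hyperbolicSum n).nondegenerate
  have hnegO : ¬ (LinearMap.BilinForm.IsometryEquiv.neg (hyperbolicSum n)).IsOrientationPreserving := by
    rw [hyperbolicSum_isOrientationPreserving_neg_iff]
    exact Nat.not_even_iff_odd.2 hodd
  have hgen : ∀ s ∈ {χ : (hyperbolicSum n).IsometryEquiv (hyperbolicSum n) | ∃ s ∈ {ψ : (hyperbolicSum n).IsometryEquiv (hyperbolicSum n) |
      ∃ (r : (Fin n → ℤ) × (Fin n → ℤ)) (hr : hyperbolicSum n r r = -1 + -1), ψ = normTwoReflectionEquiv hB r (-1) hr (by norm_num)},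
      χ = s.trans (LinearMap.BilinForm.IsometryEquiv.neg (hyperbolicSum n))},
      s.IsOrientationPreserving ↔ LinearMap.det ((s : (hyperbolicSum n).IsometryEquiv (hyperbolicSum n)) :
        (Fin n → ℤ) × (Fin n → ℤ) →ₗ[ℤ] (Fin n → ℤ) × (Fin n → ℤ)) = 1 := by
    rintro s ⟨ψ, ⟨r, hr, rfl⟩, rfl⟩
    rw [LinearMap.BilinForm.IsometryEquiv.isOrientationPreserving_trans_iff hB hnd, IsometryEquiv.det_trans_eq_mul, hyperbolicSum_det_neg,
      isOrientationPreserving_normTwoReflectionEquiv_iff _ hB hnd, det_normTwoReflectionEquiv _ hB]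
    simp only [iff_true, one_mul]
    exact iff_of_false hnegO (by norm_num)
  obtain ⟨hS, hSdet⟩ := reflections_symm_mem_and_det hB (ε := -1) (by norm_num)
  refine ⟨fun hφ ↦ hφ.isOrientationPreserving_iff_det_eq_one hB hnd hgen, fun h ↦ ?_⟩
  rcases LinearMap.BilinForm.IsometryEquiv.det_eq_one_or_eq_neg_one φ with hd | hd
  · -- `φ ∈ SO⁺`: an even word in `(−2)`-reflections, i.e. a word in negated pairs
    obtain ⟨l, hl, hlφ⟩ := ((hyperbolicSum_isWordIn_negTwoReflections_iff hn φ).2 (h.2 hd)).exists_list_of_symm_mem hS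
    have heven : Even l.length := by
      rcases Nat.even_or_odd l.length with h' | h'
      · exact h'
      · have hdl := det_wordProd_eq_neg_one_pow l fun s hs ↦ hSdet s (hl s hs)
        rw [DFunLike.ext _ _ hlφ, hd, h'.neg_one_pow] at hdl
        norm_num at hdl
    exact (isWordIn_negs_wordProd l hl (Or.inl heven)).congr hlφ
  · -- `φ ∉ O⁺`, `det φ = −1`: `φ·(−σ₋) ∈ SO⁺`
    have hφO : ¬ φ.IsOrientationPreserving := fun h' ↦ by rw [h.1 h'] at hd; norm_num at hd
    have hv := hyperbolicSum_single_neg_single n ⟨0, by omega⟩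
    set σ := normTwoReflectionEquiv hB (Pi.single (⟨0, by omega⟩ : Fin n) 1, -Pi.single (⟨0, by omega⟩ : Fin n) 1) (-1) hv
      (by norm_num) with hσ
    have hσO : σ.IsOrientationPreserving := by
      rw [hσ, isOrientationPreserving_normTwoReflectionEquiv_iff _ hB hnd]
    set τ := σ.trans (LinearMap.BilinForm.IsometryEquiv.neg (hyperbolicSum n)) with hτ
    have hφτ₁ : (φ.trans τ).IsOrientationPreserving := by
      rw [LinearMap.BilinForm.IsometryEquiv.isOrientationPreserving_trans_iff hB hnd, hτ,
        LinearMap.BilinForm.IsometryEquiv.isOrientationPreserving_trans_iff hB hnd]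
      exact iff_of_false (fun h' ↦ hnegO (h'.2 hσO)) hφO
    have hφτ₂ : LinearMap.det ((φ.trans τ : (hyperbolicSum n).IsometryEquiv (hyperbolicSum n)) :
        (Fin n → ℤ) × (Fin n → ℤ) →ₗ[ℤ] (Fin n → ℤ) × (Fin n → ℤ)) = 1 := by
      rw [IsometryEquiv.det_trans_eq_mul, hτ, IsometryEquiv.det_trans_eq_mul, hyperbolicSum_det_neg, hσ, det_normTwoReflectionEquiv _ hB, hd]
      norm_num
    obtain ⟨l, hl, hlφ⟩ := ((hyperbolicSum_isWordIn_negTwoReflections_iff hn _).2 hφτ₁).exists_list_of_symm_mem hS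
    have heven : Even l.length := by
      rcases Nat.even_or_odd l.length with h' | h'
      · exact h'
      · have hdl := det_wordProd_eq_neg_one_pow l fun s hs ↦ hSdet s (hl s hs)
        rw [DFunLike.ext _ _ hlφ, hφτ₂, h'.neg_one_pow] at hdl
        norm_num at hdl
    have hw := (isWordIn_negs_wordProd l hl (Or.inl heven)).congr hlφ
    -- `φ = (φτ)τ` since `τ² = id`
    refine (hw.trans (IsWordIn.of_mem ⟨σ, ⟨_, hv, rfl⟩, rfl⟩)).congr fun v ↦ ?_
    simp only [LinearMap.BilinForm.IsometryEquiv.trans_apply, hτ, LinearMap.BilinForm.IsometryEquiv.neg_apply, map_neg, neg_neg]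
    rw [hσ, normTwoReflectionEquiv_apply_apply]

end HyperbolicSum

/-! ### §3 Every lattice isometric to `U^{⊕n}` and the genus `II_{n,n}`, `n ≥ 3` -/

section Model

variable {W W' : Type} [AddCommGroup W] [Module.Finite ℤ W] [Module.Free ℤ W] [AddCommGroup W'] [Module.Finite ℤ W']
  [Module.Free ℤ W'] {B : BilinForm ℤ W} {B' : BilinForm ℤ W'}

omit [Module.Finite ℤ W] [Module.Free ℤ W] [Module.Finite ℤ W'] [Module.Free ℤ W'] in
/-- **Words in `(+2)`-reflections transport along isometries** (`γσ_rγ⁻¹ = σ_{γ(r)}`).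
[cite: GritsenkoHulekSankaran2009, §3.1 ("γσ_rγ⁻¹ = σ_{γ(r)}")] -/
theorem IsWordIn.posTwoReflections_conj (hB : B.IsSymm) (hB' : B'.IsSymm) {φ : B.IsometryEquiv B}
    (hφ : IsWordIn {ψ : B.IsometryEquiv B | ∃ (r : W) (hr : B r r = 1 + 1), ψ = normTwoReflectionEquiv hB r 1 hr (by norm_num)} φ)
    (e : B.IsometryEquiv B') :
    IsWordIn {ψ' : B'.IsometryEquiv B' | ∃ (r : W') (hr : B' r r = 1 + 1), ψ' = normTwoReflectionEquiv hB' r 1 hr (by norm_num)}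
      (e.symm.trans (φ.trans e)) := by
  refine (hφ.conj e).bind fun s hs ↦ ?_
  obtain ⟨ψ, ⟨r, hr, rfl⟩, rfl⟩ := hs
  have hr' : B' (e r) (e r) = 1 + 1 := by rw [e.map_app, hr]
  exact IsWordIn.congr (IsWordIn.of_mem (φ := normTwoReflectionEquiv hB' (e r) 1 hr' (by norm_num)) ⟨e r, hr', rfl⟩)
    fun v ↦ (normTwoReflectionEquiv_conj_apply hB hB' e hr (by norm_num) hr' v).symm

/-- **`⟨σ_v : v² = +2⟩ = ker(χ·det) = O⁺(L(−1))` for every `L ≅ U^{⊕n}`, `n ≥ 3`.**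
[cite: GritsenkoHulekSankaran2009, Thm. 1.1 and Cor. 1.2 ("also true with opposite signs")] [cite: GritsenkoHulekSankaran2007HM, §3] -/
theorem isWordIn_posTwoReflections_iff_of_isometryEquiv_hyperbolicSum {n : ℕ} (hn : 3 ≤ n) (hB' : B'.IsSymm)
    (hnd' : B'.Nondegenerate) (e : (hyperbolicSum n).IsometryEquiv B') (φ' : B'.IsometryEquiv B') :
    IsWordIn {ψ' : B'.IsometryEquiv B' | ∃ (r : W') (hr : B' r r = 1 + 1), ψ' = normTwoReflectionEquiv hB' r 1 hr (by norm_num)} φ' ↔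
      (φ'.IsOrientationPreserving ↔ LinearMap.det (φ' : W' →ₗ[ℤ] W') = 1) := by
  constructor
  · intro hφ
    refine hφ.isOrientationPreserving_iff_det_eq_one hB' hnd' fun s hs ↦ ?_
    obtain ⟨r, hr, rfl⟩ := hs
    rw [isOrientationPreserving_normTwoReflectionEquiv_iff _ hB' hnd', det_normTwoReflectionEquiv _ hB']
    norm_num
  · intro h
    have hφ₁ : (e.trans (φ'.trans e.symm)).IsOrientationPreserving ↔ φ'.IsOrientationPreserving :=
      LinearMap.BilinForm.IsometryEquiv.isOrientationPreserving_trans_trans_symm_iff e φ'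
    have hφ₂ : LinearMap.det ((e.trans (φ'.trans e.symm) : (hyperbolicSum n).IsometryEquiv _) :
        (Fin n → ℤ) × (Fin n → ℤ) →ₗ[ℤ] (Fin n → ℤ) × (Fin n → ℤ)) = LinearMap.det (φ' : W' →ₗ[ℤ] W') :=
      IsometryEquiv.det_trans_trans_symm e φ'
    have hw := (hyperbolicSum_isWordIn_posTwoReflections_iff hn (e.trans (φ'.trans e.symm))).2 (by rw [hφ₁, hφ₂]; exact h)
    exact (hw.posTwoReflections_conj (isSymm_hyperbolicSum n) hB' e).congr fun v ↦
      IsometryEquiv.symm_trans_trans_trans_symm_trans_apply e φ' v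

/-- **`⟨σ_v : v² = +2⟩ = ker(χ·det)` for the genus `II_{n,n}`, `n ≥ 3`**: for every even unimodular lattice of rank `2n` and signature `0`,
an isometry is a word in the `(+2)`-reflections iff `χ(φ) ⟺ det φ = 1` (iff `φ ⊗ ℝ ∈ O⁺(L(−1))`).
[cite: GritsenkoHulekSankaran2009, Thm. 1.1 and Cor. 1.2 ("also true with opposite signs")] [cite: Huybrechts2016K3, Ch. 14 Cor. 1.3 (i)] -/
theorem isWordIn_posTwoReflections_iff_of_isUnimodular_of_isEven (hB : B.IsSymm) (hU : B.IsUnimodular) (he : B.IsEven)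
    {n : ℕ} (hn : 3 ≤ n) (hrank : finrank ℤ W = 2 * n) (hsig : B.signature = 0) (φ : B.IsometryEquiv B) :
    IsWordIn {ψ : B.IsometryEquiv B | ∃ (r : W) (hr : B r r = 1 + 1), ψ = normTwoReflectionEquiv hB r 1 hr (by norm_num)} φ ↔
      (φ.IsOrientationPreserving ↔ LinearMap.det (φ : W →ₗ[ℤ] W) = 1) := by
  obtain ⟨e⟩ := equivalent_hyperbolicSum_of_signature_eq_zero _ hB hU he (by omega) hrank hsig
  exact isWordIn_posTwoReflections_iff_of_isometryEquiv_hyperbolicSum hn hB hU.nondegenerate e.symm φ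

/-- The same through the negative orientation character: **`⟨σ_v : v² = +2⟩ = O⁺(L(−1))` for `II_{n,n}`, `n ≥ 3`.**
[cite: GritsenkoHulekSankaran2009, Cor. 1.2 ("multiply the quadratic form of the lattice L by −1")] [cite: GritsenkoHulekSankaran2007HM, §3] -/
theorem isWordIn_posTwoReflections_iff_realForm_neg_of_isUnimodular_of_isEven (hB : B.IsSymm) (hU : B.IsUnimodular)
    (he : B.IsEven) {n : ℕ} (hn : 3 ≤ n) (hrank : finrank ℤ W = 2 * n) (hsig : B.signature = 0) (φ : B.IsometryEquiv B) :
    IsWordIn {ψ : B.IsometryEquiv B | ∃ (r : W) (hr : B r r = 1 + 1), ψ = normTwoReflectionEquiv hB r 1 hr (by norm_num)} φ ↔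
      Literature.LinearAlgebra.QuadraticForm.IsOrientationPreserving (LinearMap.BilinForm.realForm (-B))
        (LinearMap.BilinForm.realEnd (φ : W →ₗ[ℤ] W)) := by
  rw [isWordIn_posTwoReflections_iff_of_isUnimodular_of_isEven hB hU he hn hrank hsig,
    LinearMap.BilinForm.IsometryEquiv.isOrientationPreserving_realForm_neg_iff _ hB hU.nondegenerate]

end Model


end Literature.Topology.FourManifolds

end
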